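import Literature.Analysis.FluidPDE.GaussWeightedBiotSavartBounds
import HarnessLib

/-!
# The radial part: a weighted Hardy bound for the circular mean

Analysis/FluidPDE file (all results proved; one-dimensional real analysis only). The circular
mean `m(r)` of a vorticity `w` solving `(L + λM)w − αΛw = f` satisfies, after averaging over
circles and integrating the resulting ODE once (`RadialMeanIdentity`),

  `e^{r²/4} m(r) = c + ∫_1^r e^{s²/4} J(s)/s ds`,  `J(s) = 𝓕(s) − (λ/2) s² 𝒜(s)`,
  `𝓕(s) = ∫_0^s t F̄(t) dt`,

where `F̄` is the circular mean of `f` and `𝒜` the `cos 2θ`-moment of `w` (the only trace of the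
non-radial part of `w` in the radial equation). This file turns the formula into the estimate

  `∫_0^R e^{ar²/4} r m(r)² dr ≤ C(a) (∫_0^R e^{ar²/4} r F̄² dr + λ² ∫_0^R e^{ar²/4} r 𝒜² dr)`,
  `0 < a ≤ 1`,

using the mass-zero condition `∫_0^R r m = 0` to control `c`, Cauchy–Schwarz with Gaussian tails,
and a Hardy-type inequality on `[1, R]` proved by integration by parts (no Fubini). This is the
quantitative replacement, in `L²(e^{a|x|²/4})`, of the explicit inversion of `L` on radial
mass-zero functions (Gallay–Wayne; Maekawa 2009, §4, proof of Lemma 4.1, radial part).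

## References

* Y. Maekawa, *Existence of asymmetric Burgers vortices and their asymptotic behavior at large
  circulations*, Math. Models Methods Appl. Sci. 19 (2009), §4. [Maekawa2009b]
* G. H. Hardy, J. E. Littlewood, G. Pólya, *Inequalities*, CUP 1952, Thm. 330 (Hardy).
-/

noncomputable section

open Set Function Filter MeasureTheory Real intervalIntegral
open scoped Topology

namespace Literature.Analysis.FluidPDE

/-! ### Gaussian primitives -/

/-- `d/ds e^{k s²}/(2k) = s e^{k s²}`. [folklore] -/
theorem hasDerivAt_exp_mul_sq_div {k : ℝ} (hk : k ≠ 0) (s : ℝ) :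
    HasDerivAt (fun s : ℝ => Real.exp (k * s ^ 2) / (2 * k)) (s * Real.exp (k * s ^ 2)) s := by
  have h1 : HasDerivAt (fun s : ℝ => k * s ^ 2) (k * (2 * s)) s := by
    simpa using (hasDerivAt_pow 2 s).const_mul k
  have h2 := (h1.exp).div_const (2 * k)
  refine h2.congr_deriv ?_
  field_simp

/-- `∫_a^b s e^{k s²} ds = (e^{k b²} − e^{k a²})/(2k)`. [folklore] -/
theorem integral_mul_exp_mul_sq {k : ℝ} (hk : k ≠ 0) (a b : ℝ) :
    ∫ s in a..b, s * Real.exp (k * s ^ 2) = Real.exp (k * b ^ 2) / (2 * k) - Real.exp (k * a ^ 2) / (2 * k) :=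
  integral_eq_sub_of_hasDerivAt (fun s _ => hasDerivAt_exp_mul_sq_div hk s)
    ((continuous_id.mul (Real.continuous_exp.comp (continuous_const.mul (continuous_pow 2)))).intervalIntegrable _ _)

/-! ### A Hardy-type inequality with Gaussian weights on `[1, R]` -/

/-- **Hardy–Gauss inequality on `[1, R]`.** For a continuous `φ ≥ 0` and `k > 0`,
`∫_1^R r e^{−2k r²} (∫_1^r φ)² dr ≤ (4k²)⁻¹ ∫_1^R e^{−2k s²} φ(s)²/s ds`
(Cauchy–Schwarz against `s e^{k s²}`, then integration by parts in `r`; no Fubini).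
[folklore] -/
theorem hardy_gauss_interval {φ : ℝ → ℝ} (hφ : Continuous φ) (hφ0 : ∀ s, 0 ≤ φ s) {k R : ℝ}
    (hk : 0 < k) (hR : 1 ≤ R) :
    ∫ r in (1:ℝ)..R, r * Real.exp (-(2 * k) * r ^ 2) * (∫ s in (1:ℝ)..r, φ s) ^ 2 ≤
      (4 * k ^ 2)⁻¹ * ∫ s in (1:ℝ)..R, Real.exp (-(2 * k) * s ^ 2) * φ s ^ 2 / s := by
  -- the functions `g = φ²/(s e^{ks²})` (with `s ∨ 1` for global continuity), `B = (s ∨ 1) e^{ks²}`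
  set g : ℝ → ℝ := fun s => φ s ^ 2 / (max s 1 * Real.exp (k * s ^ 2)) with hg
  set B : ℝ → ℝ := fun s => max s 1 * Real.exp (k * s ^ 2) with hB
  have hmax : Continuous fun s : ℝ => max s 1 := continuous_id.max continuous_const
  have hexpk : Continuous fun s : ℝ => Real.exp (k * s ^ 2) :=
    Real.continuous_exp.comp (continuous_const.mul (continuous_pow 2))
  have hBc : Continuous B := hmax.mul hexpk
  have hB0 : ∀ s, 0 < B s := fun s => mul_pos (lt_of_lt_of_le zero_lt_one (le_max_right _ _)) (Real.exp_pos _)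
  have hgc : Continuous g := (hφ.pow 2).div hBc fun s => (hB0 s).ne'
  have hg0 : ∀ s, 0 ≤ g s := fun s => div_nonneg (sq_nonneg _) (hB0 s).le
  -- the primitive `U(r) = ∫_1^r g`
  set U : ℝ → ℝ := fun r => ∫ s in (1:ℝ)..r, g s with hU
  have hUd : ∀ r, HasDerivAt U (g r) r := fun r =>
    integral_hasDerivAt_right (hgc.intervalIntegrable _ _) (hgc.aestronglyMeasurable.stronglyMeasurableAtFilter)
      hgc.continuousAt
  have hUc : Continuous U := continuous_iff_continuousAt.2 fun r => (hUd r).continuousAt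
  have hU0 : ∀ r, 1 ≤ r → 0 ≤ U r := fun r hr => integral_nonneg hr fun s _ => hg0 s
  -- Cauchy–Schwarz on `[1, r]`
  have hCS : ∀ r, 1 ≤ r → (∫ s in (1:ℝ)..r, φ s) ^ 2 ≤ U r * (Real.exp (k * r ^ 2) / (2 * k)) := by
    intro r hr
    have h := sq_integral_sqrt_mul_le (μ := volume.restrict (Ioc 1 r)) hg0 (fun s => (hB0 s).le)
      hgc.measurable hBc.measurable (hgc.integrableOn_Icc.mono_set Ioc_subset_Icc_self)
      (hBc.integrableOn_Icc.mono_set Ioc_subset_Icc_self)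
    have hsqrt : ∀ s, Real.sqrt (g s * B s) = φ s := by
      intro s
      rw [hg, hB]
      simp only
      rw [div_mul_cancel₀ _ (hB0 s).ne', Real.sqrt_sq (hφ0 s)]
    simp_rw [hsqrt] at h
    rw [← integral_of_le hr, ← integral_of_le hr, ← integral_of_le hr] at h
    refine h.trans (mul_le_mul_of_nonneg_left ?_ (hU0 r hr))
    have hBint : ∫ s in (1:ℝ)..r, B s = Real.exp (k * r ^ 2) / (2 * k) - Real.exp (k * 1 ^ 2) / (2 * k) := by
      rw [← integral_mul_exp_mul_sq hk.ne']
      refine integral_congr fun s hs => ?_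
      rw [uIcc_of_le hr] at hs
      simp only [hB, max_eq_left hs.1]
    rw [hBint]
    have : 0 ≤ Real.exp (k * 1 ^ 2) / (2 * k) := by positivity
    linarith
  -- Step 1: pointwise bound of the integrand
  have hc1 : Continuous fun r => r * Real.exp (-(2 * k) * r ^ 2) * (∫ s in (1:ℝ)..r, φ s) ^ 2 :=
    (continuous_id.mul (Real.continuous_exp.comp (continuous_const.mul (continuous_pow 2)))).mul
      ((continuous_primitive (fun a b => hφ.intervalIntegrable a b) 1).pow 2)
  have hc2 : Continuous fun r => (2 * k)⁻¹ * (r * Real.exp (-k * r ^ 2) * U r) :=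
    continuous_const.mul ((continuous_id.mul (Real.continuous_exp.comp (continuous_const.mul
      (continuous_pow 2)))).mul hUc)
  have step1 : ∫ r in (1:ℝ)..R, r * Real.exp (-(2 * k) * r ^ 2) * (∫ s in (1:ℝ)..r, φ s) ^ 2 ≤
      ∫ r in (1:ℝ)..R, (2 * k)⁻¹ * (r * Real.exp (-k * r ^ 2) * U r) := by
    refine integral_mono_on hR (hc1.intervalIntegrable _ _) (hc2.intervalIntegrable _ _) fun r hr => ?_
    have hr1 : 1 ≤ r := hr.1
    have hr0 : 0 ≤ r := by linarith
    have hexp : Real.exp (-(2 * k) * r ^ 2) * (Real.exp (k * r ^ 2) / (2 * k)) =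
        (2 * k)⁻¹ * Real.exp (-k * r ^ 2) := by
      rw [show -(2 * k) * r ^ 2 = -k * r ^ 2 + -(k * r ^ 2) by ring, Real.exp_add, Real.exp_neg]
      field_simp
    calc r * Real.exp (-(2 * k) * r ^ 2) * (∫ s in (1:ℝ)..r, φ s) ^ 2
        ≤ r * Real.exp (-(2 * k) * r ^ 2) * (U r * (Real.exp (k * r ^ 2) / (2 * k))) :=
          mul_le_mul_of_nonneg_left (hCS r hr1) (by positivity)
      _ = r * U r * (Real.exp (-(2 * k) * r ^ 2) * (Real.exp (k * r ^ 2) / (2 * k))) := by ring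
      _ = r * U r * ((2 * k)⁻¹ * Real.exp (-k * r ^ 2)) := by rw [hexp]
      _ = (2 * k)⁻¹ * (r * Real.exp (-k * r ^ 2) * U r) := by ring
  -- Step 2: integration by parts
  set V : ℝ → ℝ := fun r => -(Real.exp (-k * r ^ 2) / (2 * k)) with hV
  have hVd : ∀ r, HasDerivAt V (r * Real.exp (-k * r ^ 2)) r := by
    intro r
    have h1 : HasDerivAt (fun s : ℝ => -k * s ^ 2) (-k * (2 * r)) r := by
      simpa using (hasDerivAt_pow 2 r).const_mul (-k)
    have h2 : HasDerivAt (fun s : ℝ => -(Real.exp (-k * s ^ 2) / (2 * k)))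
        (-(Real.exp (-k * r ^ 2) * (-k * (2 * r)) / (2 * k))) r := ((h1.exp).div_const (2 * k)).neg
    refine h2.congr_deriv ?_
    field_simp
  have hibp := integral_mul_deriv_eq_deriv_mul (a := 1) (b := R) (u := U) (v := V)
    (fun r _ => hUd r) (fun r _ => hVd r) (hgc.intervalIntegrable _ _)
    ((continuous_id.mul (Real.continuous_exp.comp (continuous_const.mul (continuous_pow 2)))).intervalIntegrable _ _)
  have hU1 : U 1 = 0 := by simp [hU]
  have step2 : ∫ r in (1:ℝ)..R, r * Real.exp (-k * r ^ 2) * U r ≤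
      (2 * k)⁻¹ * ∫ s in (1:ℝ)..R, Real.exp (-(2 * k) * s ^ 2) * φ s ^ 2 / s := by
    have e1 : ∫ r in (1:ℝ)..R, r * Real.exp (-k * r ^ 2) * U r = ∫ r in (1:ℝ)..R, U r * (r * Real.exp (-k * r ^ 2)) :=
      integral_congr fun r _ => by ring
    rw [e1, hibp, hU1, zero_mul, sub_zero]
    have hVR : U R * V R ≤ 0 := mul_nonpos_of_nonneg_of_nonpos (hU0 R hR)
      (by simp only [hV]; exact neg_nonpos.2 (by positivity))
    have e2 : ∫ r in (1:ℝ)..R, g r * V r = -((2 * k)⁻¹ * ∫ s in (1:ℝ)..R, Real.exp (-(2 * k) * s ^ 2) * φ s ^ 2 / s) := by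
      rw [← intervalIntegral.integral_const_mul, ← intervalIntegral.integral_neg]
      refine integral_congr fun s hs => ?_
      rw [uIcc_of_le hR] at hs
      have hs1 : 1 ≤ s := hs.1
      have hs0 : 0 < s := by linarith
      simp only [hg, hV, max_eq_left hs1]
      rw [show -(2 * k) * s ^ 2 = -k * s ^ 2 + -(k * s ^ 2) by ring, Real.exp_add, Real.exp_neg]
      field_simp
    rw [e2]
    linarith
  rw [intervalIntegral.integral_const_mul] at step1
  calc _ ≤ (2 * k)⁻¹ * ∫ r in (1:ℝ)..R, r * Real.exp (-k * r ^ 2) * U r := step1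
    _ ≤ (2 * k)⁻¹ * ((2 * k)⁻¹ * ∫ s in (1:ℝ)..R, Real.exp (-(2 * k) * s ^ 2) * φ s ^ 2 / s) :=
        mul_le_mul_of_nonneg_left step2 (by positivity)
    _ = _ := by
        have e : (2 * k)⁻¹ * (2 * k)⁻¹ = (4 * k ^ 2)⁻¹ := by rw [← mul_inv]; congr 1; ring
        rw [← mul_assoc, e]

/-! ### Cauchy–Schwarz bounds for the flux `𝓕(s) = ∫_0^s t F̄(t) dt` -/

/-- `(∫_a^b |t| |F|)² ≤ (∫_a^b e^{at²/4}|t| F²)(∫_a^b |t| e^{−at²/4})` (Cauchy–Schwarz). [folklore] -/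
theorem sq_integral_abs_mul_le_gauss {F : ℝ → ℝ} (hF : Continuous F) (a : ℝ) {u v : ℝ} (huv : u ≤ v) :
    (∫ t in u..v, |t| * |F t|) ^ 2 ≤
      (∫ t in u..v, Real.exp (a / 4 * t ^ 2) * |t| * F t ^ 2) * ∫ t in u..v, |t| * Real.exp (-(a / 4 * t ^ 2)) := by
  have hAc : Continuous fun t : ℝ => Real.exp (a / 4 * t ^ 2) * |t| * F t ^ 2 :=
    ((Real.continuous_exp.comp (continuous_const.mul (continuous_pow 2))).mul continuous_abs).mul (hF.pow 2)
  have hBc : Continuous fun t : ℝ => |t| * Real.exp (-(a / 4 * t ^ 2)) :=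
    continuous_abs.mul (Real.continuous_exp.comp (continuous_const.mul (continuous_pow 2)).neg)
  have h := sq_integral_sqrt_mul_le (μ := volume.restrict (Ioc u v)) (A := fun t => Real.exp (a / 4 * t ^ 2) * |t| * F t ^ 2)
    (B := fun t => |t| * Real.exp (-(a / 4 * t ^ 2))) (fun t => by positivity) (fun t => by positivity)
    hAc.measurable hBc.measurable (hAc.integrableOn_Icc.mono_set Ioc_subset_Icc_self)
    (hBc.integrableOn_Icc.mono_set Ioc_subset_Icc_self)
  have hsqrt : ∀ t : ℝ, Real.sqrt (Real.exp (a / 4 * t ^ 2) * |t| * F t ^ 2 * (|t| * Real.exp (-(a / 4 * t ^ 2)))) = |t| * |F t| := by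
    intro t
    have he : Real.exp (a / 4 * t ^ 2) * Real.exp (-(a / 4 * t ^ 2)) = 1 := by rw [← Real.exp_add]; simp
    rw [show Real.exp (a / 4 * t ^ 2) * |t| * F t ^ 2 * (|t| * Real.exp (-(a / 4 * t ^ 2))) =
      (|t| * |F t|) ^ 2 * (Real.exp (a / 4 * t ^ 2) * Real.exp (-(a / 4 * t ^ 2))) by rw [mul_pow, sq_abs (F t)]; ring,
      he, mul_one, Real.sqrt_sq (by positivity)]
  simp_rw [hsqrt] at h
  rwa [← integral_of_le huv, ← integral_of_le huv, ← integral_of_le huv] at h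

/-- `∫_u^v |t| e^{−at²/4} dt ≤ (2/a) e^{−au²/4}` for `0 ≤ u ≤ v`, `a > 0`. [folklore] -/
theorem integral_abs_mul_exp_neg_le_tail {a u v : ℝ} (ha : 0 < a) (hu : 0 ≤ u) (huv : u ≤ v) :
    ∫ t in u..v, |t| * Real.exp (-(a / 4 * t ^ 2)) ≤ 2 / a * Real.exp (-(a / 4 * u ^ 2)) := by
  have heq : ∫ t in u..v, |t| * Real.exp (-(a / 4 * t ^ 2)) = ∫ t in u..v, t * Real.exp (-(a / 4) * t ^ 2) := by
    refine integral_congr fun t ht => ?_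
    rw [uIcc_of_le huv] at ht
    rw [abs_of_nonneg (hu.trans ht.1)]; ring_nf
  rw [heq, integral_mul_exp_mul_sq (by linarith : -(a / 4) ≠ 0)]
  have h1 : Real.exp (-(a / 4) * v ^ 2) / (2 * -(a / 4)) ≤ 0 :=
    div_nonpos_of_nonneg_of_nonpos (Real.exp_pos _).le (by linarith)
  have h2 : -(Real.exp (-(a / 4) * u ^ 2) / (2 * -(a / 4))) = 2 / a * Real.exp (-(a / 4 * u ^ 2)) := by
    rw [show -(a / 4) * u ^ 2 = -(a / 4 * u ^ 2) by ring]
    field_simp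
    norm_num
  linarith

/-- `∫_u^v |t| e^{−at²/4} dt ≤ v²/2` for `0 ≤ u ≤ v`, `a ≥ 0`. [folklore] -/
theorem integral_abs_mul_exp_neg_le_near {a u v : ℝ} (ha : 0 ≤ a) (hu : 0 ≤ u) (huv : u ≤ v) :
    ∫ t in u..v, |t| * Real.exp (-(a / 4 * t ^ 2)) ≤ v ^ 2 / 2 := by
  have hc : Continuous fun t : ℝ => |t| * Real.exp (-(a / 4 * t ^ 2)) :=
    continuous_abs.mul (Real.continuous_exp.comp (continuous_const.mul (continuous_pow 2)).neg)
  calc ∫ t in u..v, |t| * Real.exp (-(a / 4 * t ^ 2)) ≤ ∫ t in u..v, t := by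
        refine integral_mono_on huv (hc.intervalIntegrable _ _) (continuous_id.intervalIntegrable _ _) fun t ht => ?_
        rw [abs_of_nonneg (hu.trans ht.1)]
        have : Real.exp (-(a / 4 * t ^ 2)) ≤ 1 := Real.exp_le_one_iff.2 (by nlinarith [sq_nonneg t])
        nlinarith [hu.trans ht.1]
    _ = (v ^ 2 - u ^ 2) / 2 := integral_id
    _ ≤ v ^ 2 / 2 := by nlinarith [sq_nonneg u]

/-- **Tail bound of the flux**: if `∫_0^R tF̄ = 0` then for `0 ≤ s ≤ R`,
`(∫_0^s tF̄)² ≤ (2/a) e^{−as²/4} ∫_s^R e^{at²/4} t F̄²`. [folklore] -/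
theorem flux_sq_le_tail {F : ℝ → ℝ} (hF : Continuous F) {a R : ℝ} (ha : 0 < a)
    (hflux : ∫ t in (0:ℝ)..R, t * F t = 0) {s : ℝ} (hs0 : 0 ≤ s) (hsR : s ≤ R) :
    (∫ t in (0:ℝ)..s, t * F t) ^ 2 ≤
      2 / a * Real.exp (-(a / 4 * s ^ 2)) * ∫ t in s..R, Real.exp (a / 4 * t ^ 2) * t * F t ^ 2 := by
  have hc : Continuous fun t : ℝ => t * F t := continuous_id.mul hF
  have hsplit : ∫ t in (0:ℝ)..s, t * F t = -∫ t in s..R, t * F t := by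
    have := integral_add_adjacent_intervals (hc.intervalIntegrable (μ := volume) 0 s)
      (hc.intervalIntegrable (μ := volume) s R)
    linarith
  rw [hsplit, neg_sq]
  have h1 : |∫ t in s..R, t * F t| ≤ ∫ t in s..R, |t| * |F t| := by
    simpa only [abs_mul] using abs_integral_le_integral_abs (f := fun t => t * F t) (μ := volume) hsR
  have h1' : (∫ t in s..R, t * F t) ^ 2 ≤ (∫ t in s..R, |t| * |F t|) ^ 2 := by
    rw [← sq_abs]; exact pow_le_pow_left₀ (abs_nonneg _) h1 2
  have h2 := sq_integral_abs_mul_le_gauss hF a hsR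
  have h3 := integral_abs_mul_exp_neg_le_tail ha hs0 hsR
  have hA0 : 0 ≤ ∫ t in s..R, Real.exp (a / 4 * t ^ 2) * |t| * F t ^ 2 :=
    integral_nonneg hsR fun t _ => by positivity
  have heq : ∫ t in s..R, Real.exp (a / 4 * t ^ 2) * |t| * F t ^ 2 = ∫ t in s..R, Real.exp (a / 4 * t ^ 2) * t * F t ^ 2 := by
    refine integral_congr fun t ht => ?_
    rw [uIcc_of_le hsR] at ht
    rw [abs_of_nonneg (hs0.trans ht.1)]
  rw [← heq]
  calc (∫ t in s..R, t * F t) ^ 2 ≤ (∫ t in s..R, |t| * |F t|) ^ 2 := h1'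
    _ ≤ _ := h2
    _ ≤ (∫ t in s..R, Real.exp (a / 4 * t ^ 2) * |t| * F t ^ 2) * (2 / a * Real.exp (-(a / 4 * s ^ 2))) :=
        mul_le_mul_of_nonneg_left h3 hA0
    _ = _ := by ring

/-- **Near-zero bound of the flux**: for `0 ≤ s`, `(∫_0^s tF̄)² ≤ (s²/2) ∫_0^s e^{at²/4} t F̄²`
(`a ≥ 0`). [folklore] -/
theorem flux_sq_le_near {F : ℝ → ℝ} (hF : Continuous F) {a : ℝ} (ha : 0 ≤ a) {s : ℝ} (hs0 : 0 ≤ s) :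
    (∫ t in (0:ℝ)..s, t * F t) ^ 2 ≤ s ^ 2 / 2 * ∫ t in (0:ℝ)..s, Real.exp (a / 4 * t ^ 2) * t * F t ^ 2 := by
  have h1 : |∫ t in (0:ℝ)..s, t * F t| ≤ ∫ t in (0:ℝ)..s, |t| * |F t| := by
    simpa only [abs_mul] using abs_integral_le_integral_abs (f := fun t => t * F t) (μ := volume) hs0
  have h1' : (∫ t in (0:ℝ)..s, t * F t) ^ 2 ≤ (∫ t in (0:ℝ)..s, |t| * |F t|) ^ 2 := by
    rw [← sq_abs]; exact pow_le_pow_left₀ (abs_nonneg _) h1 2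
  have h2 := sq_integral_abs_mul_le_gauss hF a hs0
  have h3 := integral_abs_mul_exp_neg_le_near ha le_rfl hs0
  have hA0 : 0 ≤ ∫ t in (0:ℝ)..s, Real.exp (a / 4 * t ^ 2) * |t| * F t ^ 2 :=
    integral_nonneg hs0 fun t _ => by positivity
  have heq : ∫ t in (0:ℝ)..s, Real.exp (a / 4 * t ^ 2) * |t| * F t ^ 2 = ∫ t in (0:ℝ)..s, Real.exp (a / 4 * t ^ 2) * t * F t ^ 2 := by
    refine integral_congr fun t ht => ?_
    rw [uIcc_of_le hs0] at ht
    rw [abs_of_nonneg ht.1]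
  rw [← heq]
  calc (∫ t in (0:ℝ)..s, t * F t) ^ 2 ≤ (∫ t in (0:ℝ)..s, |t| * |F t|) ^ 2 := h1'
    _ ≤ _ := h2
    _ ≤ (∫ t in (0:ℝ)..s, Real.exp (a / 4 * t ^ 2) * |t| * F t ^ 2) * (s ^ 2 / 2) :=
        mul_le_mul_of_nonneg_left h3 hA0
    _ = _ := by ring

/-- **Near-zero bound of the `cos 2θ`-moment**: `(∫_0^1 |t||𝒜|)² ≤ ½ ∫_0^1 e^{at²/4} t 𝒜²`. [folklore] -/
theorem sq_integral_abs_moment_le {A : ℝ → ℝ} (hA : Continuous A) {a : ℝ} (ha : 0 ≤ a) :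
    (∫ t in (0:ℝ)..1, |t| * |A t|) ^ 2 ≤ 1 / 2 * ∫ t in (0:ℝ)..1, Real.exp (a / 4 * t ^ 2) * t * A t ^ 2 := by
  have h2 := sq_integral_abs_mul_le_gauss hA a zero_le_one
  have h3 := integral_abs_mul_exp_neg_le_near ha le_rfl zero_le_one
  have hA0 : 0 ≤ ∫ t in (0:ℝ)..1, Real.exp (a / 4 * t ^ 2) * |t| * A t ^ 2 :=
    integral_nonneg zero_le_one fun t _ => by positivity
  have heq : ∫ t in (0:ℝ)..1, Real.exp (a / 4 * t ^ 2) * |t| * A t ^ 2 = ∫ t in (0:ℝ)..1, Real.exp (a / 4 * t ^ 2) * t * A t ^ 2 := by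
    refine integral_congr fun t ht => ?_
    rw [uIcc_of_le zero_le_one] at ht
    rw [abs_of_nonneg ht.1]
  rw [← heq]
  calc _ ≤ _ := h2
    _ ≤ (∫ t in (0:ℝ)..1, Real.exp (a / 4 * t ^ 2) * |t| * A t ^ 2) * ((1:ℝ) ^ 2 / 2) :=
        mul_le_mul_of_nonneg_left h3 hA0
    _ = _ := by ring

/-! ### The primitive `Ψ(r) = ∫_1^r ψ`, `ψ(s) = e^{s²/4} (𝓕(s) − (λ/2) s² 𝒜(s))/s` -/

/-- Monotonicity of the weighted norms in the interval. [folklore] -/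
theorem weightedSq_mono {G : ℝ → ℝ} (hG : Continuous G) (a : ℝ) {R u v : ℝ} (hu : 0 ≤ u) (huv : u ≤ v)
    (hvR : v ≤ R) :
    ∫ t in u..v, Real.exp (a / 4 * t ^ 2) * t * G t ^ 2 ≤ ∫ t in (0:ℝ)..R, Real.exp (a / 4 * t ^ 2) * t * G t ^ 2 := by
  have hc : Continuous fun t : ℝ => Real.exp (a / 4 * t ^ 2) * t * G t ^ 2 :=
    ((Real.continuous_exp.comp (continuous_const.mul (continuous_pow 2))).mul continuous_id).mul (hG.pow 2)
  refine integral_mono_interval hu huv hvR ?_ (hc.intervalIntegrable _ _)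
  rw [EventuallyLE, ae_restrict_iff' measurableSet_Ioc]
  exact Eventually.of_forall fun t ht => by have : 0 ≤ t := ht.1.le; positivity

/-- `ψ` is continuous on `(0, ∞)`. [folklore] -/
theorem continuousOn_radialPsi {F A : ℝ → ℝ} (hF : Continuous F) (hA : Continuous A) (lam : ℝ) :
    ContinuousOn (fun s => Real.exp (s ^ 2 / 4) * ((∫ t in (0:ℝ)..s, t * F t) - lam / 2 * s ^ 2 * A s) / s) (Ioi 0) := by
  have hprim : Continuous fun s => ∫ t in (0:ℝ)..s, t * F t :=
    continuous_primitive (fun u v => (continuous_id.mul hF).intervalIntegrable u v) 0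
  have hnum : Continuous fun s => Real.exp (s ^ 2 / 4) * ((∫ t in (0:ℝ)..s, t * F t) - lam / 2 * s ^ 2 * A s) :=
    (Real.continuous_exp.comp ((continuous_pow 2).div_const 4)).mul
      (hprim.sub ((continuous_const.mul (continuous_pow 2)).mul hA))
  exact hnum.continuousOn.div continuousOn_id fun s hs => (ne_of_gt hs)

section Primitive

variable {F A : ℝ → ℝ} (hF : Continuous F) (hA : Continuous A) {a : ℝ} (lam : ℝ) {R : ℝ}
  (ha0 : 0 < a) (hR : 1 ≤ R)
include hF hA ha0 hR

omit hA in
/-- **`ψ` near the origin**: for `0 < s ≤ 1`,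
`|ψ(s)| ≤ e^{1/4} (√(N_F/2) + (|λ|/2) s |𝒜(s)|)`. [folklore] -/
theorem abs_psi_le_near {s : ℝ} (hs0 : 0 < s) (hs1 : s ≤ 1) :
    |Real.exp (s ^ 2 / 4) * ((∫ t in (0:ℝ)..s, t * F t) - lam / 2 * s ^ 2 * A s) / s| ≤ Real.exp (1 / 4) * (Real.sqrt ((∫ t in (0:ℝ)..R, Real.exp (a / 4 * t ^ 2) * t * F t ^ 2) / 2) + |lam| / 2 * (s * |A s|)) := by
  have hflux := flux_sq_le_near hF ha0.le hs0.le (a := a)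
  have hmono := weightedSq_mono hF a le_rfl hs0.le (hs1.trans hR)
  have hNF0 : 0 ≤ (∫ t in (0:ℝ)..R, Real.exp (a / 4 * t ^ 2) * t * F t ^ 2) := integral_nonneg (by linarith) fun t ht => by have : 0 ≤ t := ht.1; positivity
  have h1 : |∫ t in (0:ℝ)..s, t * F t| ≤ s * Real.sqrt ((∫ t in (0:ℝ)..R, Real.exp (a / 4 * t ^ 2) * t * F t ^ 2) / 2) := by
    have h2 : (∫ t in (0:ℝ)..s, t * F t) ^ 2 ≤ (s * Real.sqrt ((∫ t in (0:ℝ)..R, Real.exp (a / 4 * t ^ 2) * t * F t ^ 2) / 2)) ^ 2 := by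
      rw [mul_pow, Real.sq_sqrt (by positivity)]
      calc _ ≤ s ^ 2 / 2 * ∫ t in (0:ℝ)..s, Real.exp (a / 4 * t ^ 2) * t * F t ^ 2 := hflux
        _ ≤ s ^ 2 / 2 * (∫ t in (0:ℝ)..R, Real.exp (a / 4 * t ^ 2) * t * F t ^ 2) := by gcongr
        _ = _ := by ring
    exact abs_le.2 (abs_le_of_sq_le_sq' h2 (by positivity))
  have hexp : Real.exp (s ^ 2 / 4) ≤ Real.exp (1 / 4) := Real.exp_le_exp.2 (by nlinarith)
  rw [abs_div, abs_mul, abs_of_pos (Real.exp_pos _), abs_of_pos hs0, div_le_iff₀ hs0]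
  have h3 : |(∫ t in (0:ℝ)..s, t * F t) - lam / 2 * s ^ 2 * A s| ≤ s * Real.sqrt ((∫ t in (0:ℝ)..R, Real.exp (a / 4 * t ^ 2) * t * F t ^ 2) / 2) + |lam| / 2 * s ^ 2 * |A s| := by
    refine (abs_sub _ _).trans (add_le_add h1 ?_)
    rw [abs_mul, abs_mul, abs_div, abs_two, abs_of_pos (by positivity : (0:ℝ) < s ^ 2)]
  calc Real.exp (s ^ 2 / 4) * |(∫ t in (0:ℝ)..s, t * F t) - lam / 2 * s ^ 2 * A s|
      ≤ Real.exp (1 / 4) * (s * Real.sqrt ((∫ t in (0:ℝ)..R, Real.exp (a / 4 * t ^ 2) * t * F t ^ 2) / 2) + |lam| / 2 * s ^ 2 * |A s|) :=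
        mul_le_mul hexp h3 (abs_nonneg _) (Real.exp_pos _).le
    _ = Real.exp (1 / 4) * (Real.sqrt ((∫ t in (0:ℝ)..R, Real.exp (a / 4 * t ^ 2) * t * F t ^ 2) / 2) + |lam| / 2 * (s * |A s|)) * s := by ring

/-- **The primitive near the origin**: for `0 < r ≤ 1`,
`|∫_1^r ψ| ≤ e^{1/4} (√(N_F/2) + (|λ|/2) √(N_𝒜/2))`. [folklore] -/
theorem abs_integral_psi_le_near {r : ℝ} (hr0 : 0 < r) (hr1 : r ≤ 1) :
    |∫ s in (1:ℝ)..r, Real.exp (s ^ 2 / 4) * ((∫ t in (0:ℝ)..s, t * F t) - lam / 2 * s ^ 2 * A s) / s| ≤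
      Real.exp (1 / 4) * (Real.sqrt ((∫ t in (0:ℝ)..R, Real.exp (a / 4 * t ^ 2) * t * F t ^ 2) / 2) + |lam| / 2 * Real.sqrt ((∫ t in (0:ℝ)..R, Real.exp (a / 4 * t ^ 2) * t * A t ^ 2) / 2)) := by
  have hNF0 : 0 ≤ (∫ t in (0:ℝ)..R, Real.exp (a / 4 * t ^ 2) * t * F t ^ 2) := integral_nonneg (by linarith) fun t ht => by have : 0 ≤ t := ht.1; positivity
  have hNA0 : 0 ≤ (∫ t in (0:ℝ)..R, Real.exp (a / 4 * t ^ 2) * t * A t ^ 2) := integral_nonneg (by linarith) fun t ht => by have : 0 ≤ t := ht.1; positivity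
  have hψi : IntervalIntegrable (fun s => Real.exp (s ^ 2 / 4) * ((∫ t in (0:ℝ)..s, t * F t) - lam / 2 * s ^ 2 * A s) / s) volume r 1 :=
    ((continuousOn_radialPsi hF hA lam).mono (by
      rw [uIcc_of_le hr1]; exact fun s hs => lt_of_lt_of_le hr0 hs.1)).intervalIntegrable
  have hcA : Continuous fun s : ℝ => |s| * |A s| := continuous_abs.mul hA.abs
  have hbound : Continuous fun s : ℝ => Real.exp (1 / 4) * (Real.sqrt ((∫ t in (0:ℝ)..R, Real.exp (a / 4 * t ^ 2) * t * F t ^ 2) / 2) + |lam| / 2 * (|s| * |A s|)) :=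
    continuous_const.mul (continuous_const.add (continuous_const.mul hcA))
  have i2 : ∫ s in r..(1:ℝ), |s| * |A s| ≤ ∫ s in (0:ℝ)..(1:ℝ), |s| * |A s| :=
    integral_mono_interval hr0.le hr1 le_rfl (Eventually.of_forall fun s => by positivity) (hcA.intervalIntegrable _ _)
  have i3 : ∫ s in (0:ℝ)..(1:ℝ), |s| * |A s| ≤ Real.sqrt ((∫ t in (0:ℝ)..R, Real.exp (a / 4 * t ^ 2) * t * A t ^ 2) / 2) := by
    have h := sq_integral_abs_moment_le hA ha0.le (a := a)
    have hm := weightedSq_mono hA a le_rfl zero_le_one hR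
    exact (le_abs_self _).trans (Real.abs_le_sqrt (by linarith))
  rw [integral_symm, abs_neg]
  calc |∫ s in r..(1:ℝ), Real.exp (s ^ 2 / 4) * ((∫ t in (0:ℝ)..s, t * F t) - lam / 2 * s ^ 2 * A s) / s| ≤ ∫ s in r..(1:ℝ), |Real.exp (s ^ 2 / 4) * ((∫ t in (0:ℝ)..s, t * F t) - lam / 2 * s ^ 2 * A s) / s| := abs_integral_le_integral_abs hr1
    _ ≤ ∫ s in r..(1:ℝ), Real.exp (1 / 4) * (Real.sqrt ((∫ t in (0:ℝ)..R, Real.exp (a / 4 * t ^ 2) * t * F t ^ 2) / 2) + |lam| / 2 * (|s| * |A s|)) := by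
        refine integral_mono_on hr1 hψi.abs (hbound.intervalIntegrable _ _) fun s hs => ?_
        have hs' : 0 < s := lt_of_lt_of_le hr0 hs.1
        have h := abs_psi_le_near hF lam ha0 hR hs' hs.2 (A := A)
        refine h.trans (le_of_eq ?_)
        rw [abs_of_pos hs']
    _ = Real.exp (1 / 4) * (Real.sqrt ((∫ t in (0:ℝ)..R, Real.exp (a / 4 * t ^ 2) * t * F t ^ 2) / 2) * (1 - r) + |lam| / 2 * ∫ s in r..(1:ℝ), |s| * |A s|) := by
        rw [intervalIntegral.integral_const_mul, intervalIntegral.integral_add intervalIntegrable_const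
          ((hcA.intervalIntegrable _ _).const_mul _), intervalIntegral.integral_const,
          intervalIntegral.integral_const_mul, smul_eq_mul]
        ring
    _ ≤ Real.exp (1 / 4) * (Real.sqrt ((∫ t in (0:ℝ)..R, Real.exp (a / 4 * t ^ 2) * t * F t ^ 2) / 2) * 1 + |lam| / 2 * Real.sqrt ((∫ t in (0:ℝ)..R, Real.exp (a / 4 * t ^ 2) * t * A t ^ 2) / 2)) := by
        refine mul_le_mul_of_nonneg_left (add_le_add ?_ ?_) (Real.exp_pos _).le
        · exact mul_le_mul_of_nonneg_left (by linarith) (Real.sqrt_nonneg _)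
        · exact mul_le_mul_of_nonneg_left (i2.trans i3) (by positivity)
    _ = _ := by rw [mul_one]

end Primitive

/-! ### The primitive on `[1, R]` -/

/-- The majorant `ψ_F(s) = √(2/a) e^{(2−a)s²/8} T(s)/(s ∨ 1)`, `T(s)² = ∫_s^R e^{at²/4} t F̄²`, is
continuous and nonnegative. [folklore] -/
theorem continuous_psiF {F : ℝ → ℝ} (hF : Continuous F) {a : ℝ} (ha0 : 0 < a) (R : ℝ) :
    Continuous (fun s : ℝ => (Real.sqrt (2 / a) * Real.exp ((2 - a) / 8 * s ^ 2) * Real.sqrt (∫ t in s..R, Real.exp (a / 4 * t ^ 2) * t * F t ^ 2) / max s 1)) ∧ ∀ s : ℝ, 0 ≤ (Real.sqrt (2 / a) * Real.exp ((2 - a) / 8 * s ^ 2) * Real.sqrt (∫ t in s..R, Real.exp (a / 4 * t ^ 2) * t * F t ^ 2) / max s 1) := by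
  have hc : Continuous fun t : ℝ => Real.exp (a / 4 * t ^ 2) * t * F t ^ 2 :=
    ((Real.continuous_exp.comp (continuous_const.mul (continuous_pow 2))).mul continuous_id).mul (hF.pow 2)
  have hT : Continuous fun s : ℝ => (∫ t in s..R, Real.exp (a / 4 * t ^ 2) * t * F t ^ 2) := by
    have h := continuous_primitive (μ := volume) (fun u v => hc.intervalIntegrable u v) R
    have : (fun s : ℝ => (∫ t in s..R, Real.exp (a / 4 * t ^ 2) * t * F t ^ 2)) = fun s => -∫ t in R..s, Real.exp (a / 4 * t ^ 2) * t * F t ^ 2 :=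
      funext fun s => integral_symm _ _
    rw [this]; exact h.neg
  refine ⟨((continuous_const.mul (Real.continuous_exp.comp (continuous_const.mul (continuous_pow 2)))).mul
    (Real.continuous_sqrt.comp hT)).div (continuous_id.max continuous_const)
    fun s => (lt_of_lt_of_le zero_lt_one (le_max_right _ _)).ne', fun s => ?_⟩
  have : 0 < max s 1 := lt_of_lt_of_le zero_lt_one (le_max_right _ _)
  positivity

/-- The majorant `ψ_𝒜(s) = (|λ|/2)|s| e^{s²/4}|𝒜(s)|` is continuous and nonnegative. [folklore] -/
theorem continuous_psiA {A : ℝ → ℝ} (hA : Continuous A) (lam : ℝ) :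
    Continuous (fun s : ℝ => (|lam| / 2 * |s| * Real.exp (s ^ 2 / 4) * |A s|)) ∧ ∀ s : ℝ, 0 ≤ (|lam| / 2 * |s| * Real.exp (s ^ 2 / 4) * |A s|) :=
  ⟨((continuous_const.mul continuous_abs).mul (Real.continuous_exp.comp ((continuous_pow 2).div_const 4))).mul
    hA.abs, fun s => by positivity⟩

/-- **`ψ` on `[1, R]`**: `|ψ(s)| ≤ ψ_F(s) + ψ_𝒜(s)`. [folklore] -/
theorem abs_psi_le_far {F A : ℝ → ℝ} (hF : Continuous F) (lam : ℝ) {a R : ℝ} (ha0 : 0 < a)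
    (hflux : ∫ t in (0:ℝ)..R, t * F t = 0) {s : ℝ} (hs1 : 1 ≤ s) (hsR : s ≤ R) :
    |Real.exp (s ^ 2 / 4) * ((∫ t in (0:ℝ)..s, t * F t) - lam / 2 * s ^ 2 * A s) / s| ≤ (Real.sqrt (2 / a) * Real.exp ((2 - a) / 8 * s ^ 2) * Real.sqrt (∫ t in s..R, Real.exp (a / 4 * t ^ 2) * t * F t ^ 2) / max s 1) + (|lam| / 2 * |s| * Real.exp (s ^ 2 / 4) * |A s|) := by
  have hs0 : 0 < s := by linarith
  have hT0 : 0 ≤ (∫ t in s..R, Real.exp (a / 4 * t ^ 2) * t * F t ^ 2) := integral_nonneg hsR fun t ht => by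
    have h0 : 0 ≤ t := by linarith [ht.1]
    positivity
  have h1 := flux_sq_le_tail hF ha0 hflux hs0.le hsR
  have h2 : |∫ t in (0:ℝ)..s, t * F t| ≤ Real.sqrt (2 / a) * Real.exp (-(a / 8 * s ^ 2)) * Real.sqrt (∫ t in s..R, Real.exp (a / 4 * t ^ 2) * t * F t ^ 2) := by
    have h3 := Real.abs_le_sqrt h1
    rw [Real.sqrt_mul (by positivity), Real.sqrt_mul (by positivity), ← Real.exp_half] at h3
    have : -(a / 4 * s ^ 2) / 2 = -(a / 8 * s ^ 2) := by ring
    rwa [this] at h3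
  have key : |Real.exp (s ^ 2 / 4) * ((∫ t in (0:ℝ)..s, t * F t) - lam / 2 * s ^ 2 * A s) / s| ≤ (Real.sqrt (2 / a) * Real.exp ((2 - a) / 8 * s ^ 2) * Real.sqrt (∫ t in s..R, Real.exp (a / 4 * t ^ 2) * t * F t ^ 2) / max s 1) + |lam| / 2 * s * Real.exp (s ^ 2 / 4) * |A s| := by
    rw [abs_div, abs_mul, abs_of_pos (Real.exp_pos _), abs_of_pos hs0, max_eq_left hs1, div_le_iff₀ hs0]
    have h4 : |(∫ t in (0:ℝ)..s, t * F t) - lam / 2 * s ^ 2 * A s| ≤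
        Real.sqrt (2 / a) * Real.exp (-(a / 8 * s ^ 2)) * Real.sqrt (∫ t in s..R, Real.exp (a / 4 * t ^ 2) * t * F t ^ 2) + |lam| / 2 * s ^ 2 * |A s| := by
      refine (abs_sub _ _).trans (add_le_add h2 ?_)
      rw [abs_mul, abs_mul, abs_div, abs_two, abs_of_pos (by positivity : (0:ℝ) < s ^ 2)]
    have hexp : Real.exp (s ^ 2 / 4) * Real.exp (-(a / 8 * s ^ 2)) = Real.exp ((2 - a) / 8 * s ^ 2) := by
      rw [← Real.exp_add]; ring_nf
    calc Real.exp (s ^ 2 / 4) * |(∫ t in (0:ℝ)..s, t * F t) - lam / 2 * s ^ 2 * A s|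
        ≤ Real.exp (s ^ 2 / 4) * (Real.sqrt (2 / a) * Real.exp (-(a / 8 * s ^ 2)) * Real.sqrt (∫ t in s..R, Real.exp (a / 4 * t ^ 2) * t * F t ^ 2) +
            |lam| / 2 * s ^ 2 * |A s|) := mul_le_mul_of_nonneg_left h4 (Real.exp_pos _).le
      _ = (Real.sqrt (2 / a) * (Real.exp (s ^ 2 / 4) * Real.exp (-(a / 8 * s ^ 2))) * Real.sqrt (∫ t in s..R, Real.exp (a / 4 * t ^ 2) * t * F t ^ 2) / s +
            |lam| / 2 * s * Real.exp (s ^ 2 / 4) * |A s|) * s := by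
          field_simp
      _ = _ := by rw [hexp]
  simpa only [abs_of_pos hs0] using key

/-- **Square of the primitive on `[1, R]`**: `(∫_1^r ψ)² ≤ 2(∫_1^r ψ_F)² + 2(∫_1^r ψ_𝒜)²`. [folklore] -/
theorem sq_integral_psi_le_far {F A : ℝ → ℝ} (hF : Continuous F) (hA : Continuous A) (lam : ℝ) {a R : ℝ}
    (ha0 : 0 < a) (hflux : ∫ t in (0:ℝ)..R, t * F t = 0) {r : ℝ} (hr1 : 1 ≤ r) (hrR : r ≤ R) :
    (∫ s in (1:ℝ)..r, Real.exp (s ^ 2 / 4) * ((∫ t in (0:ℝ)..s, t * F t) - lam / 2 * s ^ 2 * A s) / s) ^ 2 ≤ 2 * (∫ s in (1:ℝ)..r, (Real.sqrt (2 / a) * Real.exp ((2 - a) / 8 * s ^ 2) * Real.sqrt (∫ t in s..R, Real.exp (a / 4 * t ^ 2) * t * F t ^ 2) / max s 1)) ^ 2 + 2 * (∫ s in (1:ℝ)..r, (|lam| / 2 * |s| * Real.exp (s ^ 2 / 4) * |A s|)) ^ 2 := by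
  obtain ⟨hFc, hF0⟩ := continuous_psiF hF ha0 R
  obtain ⟨hAc, hA0⟩ := continuous_psiA hA lam
  have hψi : IntervalIntegrable (fun s => Real.exp (s ^ 2 / 4) * ((∫ t in (0:ℝ)..s, t * F t) - lam / 2 * s ^ 2 * A s) / s) volume 1 r :=
    ((continuousOn_radialPsi hF hA lam).mono (by
      rw [uIcc_of_le hr1]; exact fun s hs => lt_of_lt_of_le zero_lt_one hs.1)).intervalIntegrable
  have h1 : |∫ s in (1:ℝ)..r, Real.exp (s ^ 2 / 4) * ((∫ t in (0:ℝ)..s, t * F t) - lam / 2 * s ^ 2 * A s) / s| ≤ (∫ s in (1:ℝ)..r, (Real.sqrt (2 / a) * Real.exp ((2 - a) / 8 * s ^ 2) * Real.sqrt (∫ t in s..R, Real.exp (a / 4 * t ^ 2) * t * F t ^ 2) / max s 1)) + ∫ s in (1:ℝ)..r, (|lam| / 2 * |s| * Real.exp (s ^ 2 / 4) * |A s|) := by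
    calc _ ≤ ∫ s in (1:ℝ)..r, |Real.exp (s ^ 2 / 4) * ((∫ t in (0:ℝ)..s, t * F t) - lam / 2 * s ^ 2 * A s) / s| := abs_integral_le_integral_abs hr1
      _ ≤ ∫ s in (1:ℝ)..r, ((Real.sqrt (2 / a) * Real.exp ((2 - a) / 8 * s ^ 2) * Real.sqrt (∫ t in s..R, Real.exp (a / 4 * t ^ 2) * t * F t ^ 2) / max s 1) + (|lam| / 2 * |s| * Real.exp (s ^ 2 / 4) * |A s|)) :=
          integral_mono_on hr1 hψi.abs ((hFc.add hAc).intervalIntegrable _ _) fun s hs =>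
            abs_psi_le_far hF lam ha0 hflux hs.1 (hs.2.trans hrR) (A := A)
      _ = _ := intervalIntegral.integral_add (hFc.intervalIntegrable _ _) (hAc.intervalIntegrable _ _)
  have h2 : (∫ s in (1:ℝ)..r, Real.exp (s ^ 2 / 4) * ((∫ t in (0:ℝ)..s, t * F t) - lam / 2 * s ^ 2 * A s) / s) ^ 2 ≤ ((∫ s in (1:ℝ)..r, (Real.sqrt (2 / a) * Real.exp ((2 - a) / 8 * s ^ 2) * Real.sqrt (∫ t in s..R, Real.exp (a / 4 * t ^ 2) * t * F t ^ 2) / max s 1)) + ∫ s in (1:ℝ)..r, (|lam| / 2 * |s| * Real.exp (s ^ 2 / 4) * |A s|)) ^ 2 := by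
    rw [← sq_abs]; exact pow_le_pow_left₀ (abs_nonneg _) h1 2
  nlinarith [sq_nonneg ((∫ s in (1:ℝ)..r, (Real.sqrt (2 / a) * Real.exp ((2 - a) / 8 * s ^ 2) * Real.sqrt (∫ t in s..R, Real.exp (a / 4 * t ^ 2) * t * F t ^ 2) / max s 1)) - ∫ s in (1:ℝ)..r, (|lam| / 2 * |s| * Real.exp (s ^ 2 / 4) * |A s|))]

/-- `∫_1^R s⁻³ ds ≤ 1/2`. [folklore] -/
theorem integral_inv_cube_le {R : ℝ} (hR : 1 ≤ R) : ∫ s in (1:ℝ)..R, 1 / s ^ 3 ≤ 1 / 2 := by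
  have hint : IntervalIntegrable (fun s : ℝ => 1 / s ^ 3) volume 1 R :=
    (continuousOn_const.div (continuousOn_pow 3) fun s hs => by
      rw [uIcc_of_le hR] at hs; exact pow_ne_zero 3 (ne_of_gt (lt_of_lt_of_le zero_lt_one hs.1))).intervalIntegrable
  have hd : ∀ s ∈ uIcc 1 R, HasDerivAt (fun s : ℝ => -(1 / 2) * (s ^ 2)⁻¹) (1 / s ^ 3) s := by
    intro s hs
    rw [uIcc_of_le hR] at hs
    have hs0 : s ≠ 0 := ne_of_gt (lt_of_lt_of_le zero_lt_one hs.1)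
    have h := ((hasDerivAt_pow 2 s).inv (pow_ne_zero 2 hs0)).const_mul (-(1 / 2))
    refine h.congr_deriv ?_
    field_simp
    ring
  rw [integral_eq_sub_of_hasDerivAt hd hint]
  have h0 : 0 ≤ (R ^ 2)⁻¹ := by positivity
  simp only [one_pow, inv_one, mul_one]
  linarith

/-- **Hardy bound, `F`-part**: `∫_1^R r e^{−κr²} (∫_1^r ψ_F)² ≤ (4k²)⁻¹ N_F/a`, `κ = 2k = (2−a)/4`.
[folklore] -/
theorem hardy_psiF_le {F : ℝ → ℝ} (hF : Continuous F) {a R : ℝ} (ha0 : 0 < a) (ha2 : a < 2) (hR : 1 ≤ R) :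
    ∫ r in (1:ℝ)..R, r * Real.exp (-(2 * ((2 - a) / 8)) * r ^ 2) * (∫ s in (1:ℝ)..r, (Real.sqrt (2 / a) * Real.exp ((2 - a) / 8 * s ^ 2) * Real.sqrt (∫ t in s..R, Real.exp (a / 4 * t ^ 2) * t * F t ^ 2) / max s 1)) ^ 2 ≤
      (4 * ((2 - a) / 8) ^ 2)⁻¹ * ((∫ t in (0:ℝ)..R, Real.exp (a / 4 * t ^ 2) * t * F t ^ 2) / a) := by
  obtain ⟨hFc, hF0⟩ := continuous_psiF hF ha0 R
  have hk : 0 < (2 - a) / 8 := by linarith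
  have h := hardy_gauss_interval hFc hF0 hk hR
  refine h.trans (mul_le_mul_of_nonneg_left ?_ (by positivity))
  have hNF0 : 0 ≤ (∫ t in (0:ℝ)..R, Real.exp (a / 4 * t ^ 2) * t * F t ^ 2) := integral_nonneg (by linarith) fun t ht => by
    have h0 : 0 ≤ t := ht.1
    positivity
  -- pointwise on `[1, R]`: the integrand is `(2/a) T(s)²/s³ ≤ (2/a) N_F / s³`
  have hpt : ∀ s ∈ Icc 1 R, Real.exp (-(2 * ((2 - a) / 8)) * s ^ 2) * (Real.sqrt (2 / a) * Real.exp ((2 - a) / 8 * s ^ 2) * Real.sqrt (∫ t in s..R, Real.exp (a / 4 * t ^ 2) * t * F t ^ 2) / max s 1) ^ 2 / s ≤ 2 / a * (∫ t in (0:ℝ)..R, Real.exp (a / 4 * t ^ 2) * t * F t ^ 2) * (1 / s ^ 3) := by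
    intro s hs
    have hs0 : 0 < s := by linarith [hs.1]
    have hT0 : 0 ≤ (∫ t in s..R, Real.exp (a / 4 * t ^ 2) * t * F t ^ 2) := integral_nonneg hs.2 fun t ht => by
      have h0 : 0 ≤ t := by linarith [ht.1]
      positivity
    have hTle : (∫ t in s..R, Real.exp (a / 4 * t ^ 2) * t * F t ^ 2) ≤ (∫ t in (0:ℝ)..R, Real.exp (a / 4 * t ^ 2) * t * F t ^ 2) := weightedSq_mono hF a hs0.le hs.2 le_rfl
    have e2 : Real.exp ((2 - a) / 8 * s ^ 2) ^ 2 = Real.exp ((2 - a) / 4 * s ^ 2) := by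
      rw [← Real.exp_nat_mul]; congr 1; push_cast; ring
    have hsq : (Real.sqrt (2 / a) * Real.exp ((2 - a) / 8 * s ^ 2) * Real.sqrt (∫ t in s..R, Real.exp (a / 4 * t ^ 2) * t * F t ^ 2) / max s 1) ^ 2 = 2 / a * Real.exp ((2 - a) / 4 * s ^ 2) * (∫ t in s..R, Real.exp (a / 4 * t ^ 2) * t * F t ^ 2) / s ^ 2 := by
      rw [max_eq_left hs.1, div_pow, mul_pow, mul_pow, Real.sq_sqrt (by positivity : (0:ℝ) ≤ 2 / a),
        Real.sq_sqrt hT0, e2]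
    have hcancel : Real.exp (-(2 * ((2 - a) / 8)) * s ^ 2) * Real.exp ((2 - a) / 4 * s ^ 2) = 1 := by
      rw [← Real.exp_add]; ring_nf; simp
    rw [hsq]
    calc Real.exp (-(2 * ((2 - a) / 8)) * s ^ 2) * (2 / a * Real.exp ((2 - a) / 4 * s ^ 2) * (∫ t in s..R, Real.exp (a / 4 * t ^ 2) * t * F t ^ 2) / s ^ 2) / s
        = (Real.exp (-(2 * ((2 - a) / 8)) * s ^ 2) * Real.exp ((2 - a) / 4 * s ^ 2)) * (2 / a * (∫ t in s..R, Real.exp (a / 4 * t ^ 2) * t * F t ^ 2) * (1 / s ^ 3)) := by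
          field_simp
      _ = 2 / a * (∫ t in s..R, Real.exp (a / 4 * t ^ 2) * t * F t ^ 2) * (1 / s ^ 3) := by rw [hcancel, one_mul]
      _ ≤ 2 / a * (∫ t in (0:ℝ)..R, Real.exp (a / 4 * t ^ 2) * t * F t ^ 2) * (1 / s ^ 3) := by gcongr
  have hc1 : Continuous fun s : ℝ => Real.exp (-(2 * ((2 - a) / 8)) * s ^ 2) * (Real.sqrt (2 / a) * Real.exp ((2 - a) / 8 * s ^ 2) * Real.sqrt (∫ t in s..R, Real.exp (a / 4 * t ^ 2) * t * F t ^ 2) / max s 1) ^ 2 :=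
    (Real.continuous_exp.comp (continuous_const.mul (continuous_pow 2))).mul (hFc.pow 2)
  have hi1 : IntervalIntegrable (fun s : ℝ => Real.exp (-(2 * ((2 - a) / 8)) * s ^ 2) * (Real.sqrt (2 / a) * Real.exp ((2 - a) / 8 * s ^ 2) * Real.sqrt (∫ t in s..R, Real.exp (a / 4 * t ^ 2) * t * F t ^ 2) / max s 1) ^ 2 / s) volume 1 R :=
    (hc1.continuousOn.div continuousOn_id fun s hs => by
      rw [uIcc_of_le hR] at hs; exact (ne_of_gt (lt_of_lt_of_le zero_lt_one hs.1))).intervalIntegrable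
  have hi2 : IntervalIntegrable (fun s : ℝ => 2 / a * (∫ t in (0:ℝ)..R, Real.exp (a / 4 * t ^ 2) * t * F t ^ 2) * (1 / s ^ 3)) volume 1 R :=
    ((continuousOn_const.div (continuousOn_pow 3) fun s hs => by
      rw [uIcc_of_le hR] at hs; exact pow_ne_zero 3 (ne_of_gt (lt_of_lt_of_le zero_lt_one hs.1))).intervalIntegrable).const_mul _
  calc ∫ s in (1:ℝ)..R, Real.exp (-(2 * ((2 - a) / 8)) * s ^ 2) * (Real.sqrt (2 / a) * Real.exp ((2 - a) / 8 * s ^ 2) * Real.sqrt (∫ t in s..R, Real.exp (a / 4 * t ^ 2) * t * F t ^ 2) / max s 1) ^ 2 / s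
      ≤ ∫ s in (1:ℝ)..R, 2 / a * (∫ t in (0:ℝ)..R, Real.exp (a / 4 * t ^ 2) * t * F t ^ 2) * (1 / s ^ 3) := integral_mono_on hR hi1 hi2 hpt
    _ = 2 / a * (∫ t in (0:ℝ)..R, Real.exp (a / 4 * t ^ 2) * t * F t ^ 2) * ∫ s in (1:ℝ)..R, 1 / s ^ 3 := intervalIntegral.integral_const_mul _ _
    _ ≤ 2 / a * (∫ t in (0:ℝ)..R, Real.exp (a / 4 * t ^ 2) * t * F t ^ 2) * (1 / 2) := mul_le_mul_of_nonneg_left (integral_inv_cube_le hR) (by positivity)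
    _ = (∫ t in (0:ℝ)..R, Real.exp (a / 4 * t ^ 2) * t * F t ^ 2) / a := by ring

/-- **Hardy bound, `𝒜`-part**: `∫_1^R r e^{−κr²} (∫_1^r ψ_𝒜)² ≤ (4k²)⁻¹ λ² N_𝒜/4`. [folklore] -/
theorem hardy_psiA_le {A : ℝ → ℝ} (hA : Continuous A) (lam : ℝ) {a R : ℝ} (ha2 : a < 2) (hR : 1 ≤ R) :
    ∫ r in (1:ℝ)..R, r * Real.exp (-(2 * ((2 - a) / 8)) * r ^ 2) * (∫ s in (1:ℝ)..r, (|lam| / 2 * |s| * Real.exp (s ^ 2 / 4) * |A s|)) ^ 2 ≤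
      (4 * ((2 - a) / 8) ^ 2)⁻¹ * (lam ^ 2 / 4 * (∫ t in (0:ℝ)..R, Real.exp (a / 4 * t ^ 2) * t * A t ^ 2)) := by
  obtain ⟨hAc, hA0⟩ := continuous_psiA hA lam
  have hk : 0 < (2 - a) / 8 := by linarith
  have h := hardy_gauss_interval hAc hA0 hk hR
  refine h.trans (mul_le_mul_of_nonneg_left ?_ (by positivity))
  have heq : ∀ s ∈ Icc 1 R, Real.exp (-(2 * ((2 - a) / 8)) * s ^ 2) * (|lam| / 2 * |s| * Real.exp (s ^ 2 / 4) * |A s|) ^ 2 / s =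
      lam ^ 2 / 4 * (Real.exp (a / 4 * s ^ 2) * s * A s ^ 2) := by
    intro s hs
    have hs0 : 0 < s := by linarith [hs.1]
    have e2 : Real.exp (s ^ 2 / 4) ^ 2 = Real.exp (s ^ 2 / 2) := by
      rw [← Real.exp_nat_mul]; congr 1; push_cast; ring
    have hsq : (|lam| / 2 * |s| * Real.exp (s ^ 2 / 4) * |A s|) ^ 2 = lam ^ 2 / 4 * s ^ 2 * Real.exp (s ^ 2 / 2) * A s ^ 2 := by
      rw [abs_of_pos hs0, mul_pow, mul_pow, mul_pow, div_pow, sq_abs, sq_abs, e2]; norm_num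
    have hcancel : Real.exp (-(2 * ((2 - a) / 8)) * s ^ 2) * Real.exp (s ^ 2 / 2) = Real.exp (a / 4 * s ^ 2) := by
      rw [← Real.exp_add]; ring_nf
    rw [hsq, ← hcancel]
    field_simp
  have hc2 : Continuous fun s : ℝ => lam ^ 2 / 4 * (Real.exp (a / 4 * s ^ 2) * s * A s ^ 2) :=
    continuous_const.mul (((Real.continuous_exp.comp (continuous_const.mul (continuous_pow 2))).mul
      continuous_id).mul (hA.pow 2))
  calc ∫ s in (1:ℝ)..R, Real.exp (-(2 * ((2 - a) / 8)) * s ^ 2) * (|lam| / 2 * |s| * Real.exp (s ^ 2 / 4) * |A s|) ^ 2 / s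
      = ∫ s in (1:ℝ)..R, lam ^ 2 / 4 * (Real.exp (a / 4 * s ^ 2) * s * A s ^ 2) := by
        refine integral_congr fun s hs => heq s ?_
        rwa [uIcc_of_le hR] at hs
    _ = lam ^ 2 / 4 * ∫ s in (1:ℝ)..R, Real.exp (a / 4 * s ^ 2) * s * A s ^ 2 := intervalIntegral.integral_const_mul _ _
    _ ≤ lam ^ 2 / 4 * (∫ t in (0:ℝ)..R, Real.exp (a / 4 * t ^ 2) * t * A t ^ 2) := mul_le_mul_of_nonneg_left (weightedSq_mono hA a zero_le_one hR le_rfl) (by positivity)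

/-! ### The radial estimate -/

/-- `∫_0^R r e^{−k r²} dr ≤ 1/(2k)` for `k > 0`, `0 ≤ R`. [folklore] -/
theorem integral_id_mul_exp_neg_mul_sq_le {k : ℝ} (hk : 0 < k) (R : ℝ) :
    ∫ r in (0:ℝ)..R, r * Real.exp (-k * r ^ 2) ≤ 1 / (2 * k) := by
  rw [integral_mul_exp_mul_sq (by linarith : -k ≠ 0)]
  have h1 : 0 < Real.exp (-k * R ^ 2) := Real.exp_pos _
  have h2 : Real.exp (-k * R ^ 2) / (2 * -k) = -(Real.exp (-k * R ^ 2) / (2 * k)) := by field_simp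
  have h3 : 0 ≤ Real.exp (-k * R ^ 2) / (2 * k) := by positivity
  rw [h2]
  simp only [ne_eq, OfNat.ofNat_ne_zero, not_false_eq_true, zero_pow, mul_zero, Real.exp_zero]
  rw [show (1:ℝ) / (2 * -k) = -(1 / (2 * k)) by field_simp]
  linarith

/-- `∫_0^R r e^{−r²/4} dr ≥ 2/5` for `R ≥ 1`. [folklore] -/
theorem two_fifths_le_integral_mul_exp_neg {R : ℝ} (hR : 1 ≤ R) :
    2 / 5 ≤ ∫ r in (0:ℝ)..R, r * Real.exp (-(1 / 4) * r ^ 2) := by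
  rw [integral_mul_exp_mul_sq (by norm_num : -(1 / 4 : ℝ) ≠ 0)]
  have h1 : Real.exp (-(1 / 4) * R ^ 2) ≤ Real.exp (-(1 / 4)) := Real.exp_le_exp.2 (by nlinarith)
  have h2 : Real.exp (-(1 / 4 : ℝ)) ≤ 4 / 5 := by
    have h3 : (5 / 4 : ℝ) ≤ Real.exp (1 / 4) := by linarith [Real.add_one_le_exp (1 / 4 : ℝ)]
    rw [Real.exp_neg, inv_le_comm₀ (Real.exp_pos _) (by norm_num)]
    linarith
  rw [show -(1 / 4 : ℝ) * (0:ℝ) ^ 2 = 0 by ring, Real.exp_zero]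
  have key : Real.exp (-(1 / 4) * R ^ 2) / (2 * -(1 / 4 : ℝ)) - 1 / (2 * -(1 / 4 : ℝ)) =
      2 - 2 * Real.exp (-(1 / 4) * R ^ 2) := by ring
  rw [key]
  linarith

/-- Scalar bookkeeping for `radialMean_weighted_sq_le`. [folklore] -/
private theorem radial_bookkeeping {Nm X NF NA K κi c2 Ψ2 a lam : ℝ} (ha0 : 0 < a) (ha1 : a ≤ 1)
    (hNF : 0 ≤ NF) (hNA : 0 ≤ NA) (hX0 : 0 ≤ X)
    (hXle : X ≤ Ψ2 / 2 + (2 * (K * (NF / a)) + 2 * (K * (lam ^ 2 / 4 * NA)))) (hK : K ≤ 16)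
    (hΨ : Ψ2 ≤ 2 * NF + lam ^ 2 * NA / 2) (hc : c2 ≤ 25 / (2 * a) * X) (hκ : κi ≤ 4) (hκ0 : 0 ≤ κi)
    (hNm : Nm ≤ c2 * κi + 2 * X) :
    Nm ≤ 1716 / a ^ 2 * (NF + lam ^ 2 * NA) := by
  have ha' : 1 ≤ 1 / a := by rw [le_div_iff₀ ha0]; linarith
  have hNFa : 0 ≤ NF / a := by positivity
  have h1 : 2 * (K * (NF / a)) ≤ 32 * (NF / a) := by nlinarith
  have h2 : 2 * (K * (lam ^ 2 / 4 * NA)) ≤ 8 * (lam ^ 2 * NA) := by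
    have h0 : 0 ≤ lam ^ 2 / 4 * NA := by positivity
    nlinarith
  have h4 : NF ≤ 1 / a * NF := le_mul_of_one_le_left hNF ha'
  have h5 : lam ^ 2 * NA ≤ 1 / a * (lam ^ 2 * NA) := le_mul_of_one_le_left (by positivity) ha'
  have hXb : X ≤ 33 / a * (NF + lam ^ 2 * NA) := by
    have e : 33 / a * (NF + lam ^ 2 * NA) = 33 * (1 / a * NF) + 33 * (1 / a * (lam ^ 2 * NA)) := by ring
    have e2 : 32 * (NF / a) = 32 * (1 / a * NF) := by ring
    have h6 : 0 ≤ 1 / a * (lam ^ 2 * NA) := by positivity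
    have h7 : 0 ≤ 1 / a * NF := by positivity
    rw [e]; linarith
  have hcκ : c2 * κi ≤ 25 / (2 * a) * X * 4 := mul_le_mul hc hκ hκ0 (by positivity)
  have h2a : (2:ℝ) ≤ 2 / a := by rw [le_div_iff₀ ha0]; linarith
  calc Nm ≤ c2 * κi + 2 * X := hNm
    _ ≤ 25 / (2 * a) * X * 4 + 2 * X := by linarith
    _ = (50 / a + 2) * X := by ring
    _ ≤ (52 / a) * X := by
        apply mul_le_mul_of_nonneg_right _ hX0
        have e : (52:ℝ) / a = 50 / a + 2 / a := by ring
        rw [e]; linarith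
    _ ≤ (52 / a) * (33 / a * (NF + lam ^ 2 * NA)) := mul_le_mul_of_nonneg_left hXb (by positivity)
    _ = 1716 / a ^ 2 * (NF + lam ^ 2 * NA) := by field_simp; ring

/-- **The radial Hardy bound.** Let `0 < a ≤ 1`, `R ≥ 1`, `m, F̄, 𝒜` continuous with

* `∫_0^R t F̄ = 0` (total flux zero) and `∫_0^R r m = 0` (mass zero),
* `e^{r²/4} m(r) = c + ∫_1^r e^{s²/4}(𝓕(s) − (λ/2)s²𝒜(s))/s ds` for `0 < r` (the integrated radial ODE,
  `𝓕(s) = ∫_0^s tF̄`).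

Then `∫_0^R e^{ar²/4} r m² ≤ (1716/a²) (∫_0^R e^{ar²/4} r F̄² + λ² ∫_0^R e^{ar²/4} r 𝒜²)`.
(The constant is not optimised.) This is the radial half of Maekawa's inverse bound, made
quantitative. [cite: Maekawa2009b, §4 Lemma 4.1] -/
theorem radialMean_weighted_sq_le {F A m : ℝ → ℝ} (hF : Continuous F) (hA : Continuous A) (hm : Continuous m)
    {a lam R c : ℝ} (ha0 : 0 < a) (ha1 : a ≤ 1) (hR : 1 ≤ R)
    (hflux : ∫ t in (0:ℝ)..R, t * F t = 0) (hmass : ∫ r in (0:ℝ)..R, r * m r = 0)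
    (hformula : ∀ r, 0 < r → Real.exp (r ^ 2 / 4) * m r = c + ∫ s in (1:ℝ)..r, Real.exp (s ^ 2 / 4) * ((∫ t in (0:ℝ)..s, t * F t) - lam / 2 * s ^ 2 * A s) / s) :
    ∫ r in (0:ℝ)..R, Real.exp (a / 4 * r ^ 2) * r * m r ^ 2 ≤ 1716 / a ^ 2 * ((∫ t in (0:ℝ)..R, Real.exp (a / 4 * t ^ 2) * t * F t ^ 2) + lam ^ 2 * (∫ t in (0:ℝ)..R, Real.exp (a / 4 * t ^ 2) * t * A t ^ 2)) := by
  have ha2 : a < 2 := by linarith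
  have hk : 0 < (2 - a) / 8 := by linarith
  have hκ : 0 < (2 * ((2 - a) / 8)) := by linarith
  have hR0 : (0:ℝ) ≤ R := by linarith
  have hNF0 : 0 ≤ (∫ t in (0:ℝ)..R, Real.exp (a / 4 * t ^ 2) * t * F t ^ 2) := integral_nonneg hR0 fun t ht => by
    have h0 : 0 ≤ t := ht.1
    positivity
  have hNA0 : 0 ≤ (∫ t in (0:ℝ)..R, Real.exp (a / 4 * t ^ 2) * t * A t ^ 2) := integral_nonneg hR0 fun t ht => by
    have h0 : 0 ≤ t := ht.1
    positivity
  obtain ⟨hFc, hF0⟩ := continuous_psiF hF ha0 R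
  obtain ⟨hAc, hA0⟩ := continuous_psiA hA lam
  -- continuity of `Ψ(r) = e^{r²/4} m(r) − c`
  have hexpc : Continuous fun r : ℝ => Real.exp (r ^ 2 / 4) := Real.continuous_exp.comp ((continuous_pow 2).div_const 4)
  have hΨc : Continuous fun r : ℝ => (Real.exp (r ^ 2 / 4) * m r - c) := (hexpc.mul hm).sub continuous_const
  have hwc : ∀ q : ℝ, Continuous fun r : ℝ => r * Real.exp (q * r ^ 2) := fun q =>
    continuous_id.mul (Real.continuous_exp.comp (continuous_const.mul (continuous_pow 2)))
  have hXc : Continuous fun r : ℝ => r * Real.exp (-(2 * ((2 - a) / 8)) * r ^ 2) * (Real.exp (r ^ 2 / 4) * m r - c) ^ 2 := (hwc _).mul (hΨc.pow 2)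
  have hX0 : 0 ≤ (∫ r in (0:ℝ)..R, r * Real.exp (-(2 * ((2 - a) / 8)) * r ^ 2) * (Real.exp (r ^ 2 / 4) * m r - c) ^ 2) := integral_nonneg hR0 fun r hr => by
    have h0 : 0 ≤ r := hr.1
    positivity
  -- the constant `Ψ₀`
  set Ψ₀ : ℝ := Real.exp (1 / 4) * (Real.sqrt ((∫ t in (0:ℝ)..R, Real.exp (a / 4 * t ^ 2) * t * F t ^ 2) / 2) + |lam| / 2 * Real.sqrt ((∫ t in (0:ℝ)..R, Real.exp (a / 4 * t ^ 2) * t * A t ^ 2) / 2)) with hΨ₀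
  have hΨ₀0 : 0 ≤ Ψ₀ := by positivity
  have hΨ₀sq : Ψ₀ ^ 2 ≤ 2 * (∫ t in (0:ℝ)..R, Real.exp (a / 4 * t ^ 2) * t * F t ^ 2) + lam ^ 2 * (∫ t in (0:ℝ)..R, Real.exp (a / 4 * t ^ 2) * t * A t ^ 2) / 2 := by
    have he : Real.exp (1 / 4 : ℝ) ^ 2 ≤ 2 := by
      rw [← Real.exp_nat_mul]; norm_num
      have := Real.exp_one_lt_d9
      have h2 : Real.exp (1 / 2 : ℝ) ^ 2 = Real.exp 1 := by rw [← Real.exp_nat_mul]; norm_num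
      nlinarith [Real.exp_pos (1 / 2 : ℝ)]
    have h1 : (Real.sqrt ((∫ t in (0:ℝ)..R, Real.exp (a / 4 * t ^ 2) * t * F t ^ 2) / 2) + |lam| / 2 * Real.sqrt ((∫ t in (0:ℝ)..R, Real.exp (a / 4 * t ^ 2) * t * A t ^ 2) / 2)) ^ 2 ≤ (∫ t in (0:ℝ)..R, Real.exp (a / 4 * t ^ 2) * t * F t ^ 2) + lam ^ 2 * (∫ t in (0:ℝ)..R, Real.exp (a / 4 * t ^ 2) * t * A t ^ 2) / 4 := by
      have e1 : Real.sqrt ((∫ t in (0:ℝ)..R, Real.exp (a / 4 * t ^ 2) * t * F t ^ 2) / 2) ^ 2 = (∫ t in (0:ℝ)..R, Real.exp (a / 4 * t ^ 2) * t * F t ^ 2) / 2 := Real.sq_sqrt (by positivity)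
      have e2 : Real.sqrt ((∫ t in (0:ℝ)..R, Real.exp (a / 4 * t ^ 2) * t * A t ^ 2) / 2) ^ 2 = (∫ t in (0:ℝ)..R, Real.exp (a / 4 * t ^ 2) * t * A t ^ 2) / 2 := Real.sq_sqrt (by positivity)
      nlinarith [sq_nonneg (Real.sqrt ((∫ t in (0:ℝ)..R, Real.exp (a / 4 * t ^ 2) * t * F t ^ 2) / 2) - |lam| / 2 * Real.sqrt ((∫ t in (0:ℝ)..R, Real.exp (a / 4 * t ^ 2) * t * A t ^ 2) / 2)), sq_abs lam,
        Real.sqrt_nonneg ((∫ t in (0:ℝ)..R, Real.exp (a / 4 * t ^ 2) * t * F t ^ 2) / 2), Real.sqrt_nonneg ((∫ t in (0:ℝ)..R, Real.exp (a / 4 * t ^ 2) * t * A t ^ 2) / 2)]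
    rw [hΨ₀, mul_pow]
    have h0 : 0 ≤ (Real.sqrt ((∫ t in (0:ℝ)..R, Real.exp (a / 4 * t ^ 2) * t * F t ^ 2) / 2) + |lam| / 2 * Real.sqrt ((∫ t in (0:ℝ)..R, Real.exp (a / 4 * t ^ 2) * t * A t ^ 2) / 2)) ^ 2 := sq_nonneg _
    nlinarith
  -- Step A1: `∫_0^1 ≤ Ψ₀²/2`
  have hA1 : ∫ r in (0:ℝ)..1, r * Real.exp (-(2 * ((2 - a) / 8)) * r ^ 2) * (Real.exp (r ^ 2 / 4) * m r - c) ^ 2 ≤ Ψ₀ ^ 2 / 2 := by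
    have hb : ∀ r ∈ Icc (0:ℝ) 1, r * Real.exp (-(2 * ((2 - a) / 8)) * r ^ 2) * (Real.exp (r ^ 2 / 4) * m r - c) ^ 2 ≤ Ψ₀ ^ 2 * r := by
      intro r hr
      rcases hr.1.eq_or_lt with h0 | h0
      · rw [← h0]; simp
      · have hΨ : (Real.exp (r ^ 2 / 4) * m r - c) ^ 2 ≤ Ψ₀ ^ 2 := by
          have hf := hformula r h0
          have hb := abs_integral_psi_le_near hF hA lam ha0 hR h0 hr.2 (a := a)
          rw [show (Real.exp (r ^ 2 / 4) * m r - c) = ∫ s in (1:ℝ)..r, Real.exp (s ^ 2 / 4) * ((∫ t in (0:ℝ)..s, t * F t) - lam / 2 * s ^ 2 * A s) / s by linarith, ← sq_abs]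
          exact pow_le_pow_left₀ (abs_nonneg _) hb 2
        have he : Real.exp (-(2 * ((2 - a) / 8)) * r ^ 2) ≤ 1 := Real.exp_le_one_iff.2 (by nlinarith [sq_nonneg r])
        calc r * Real.exp (-(2 * ((2 - a) / 8)) * r ^ 2) * (Real.exp (r ^ 2 / 4) * m r - c) ^ 2 ≤ r * 1 * Ψ₀ ^ 2 := by gcongr
          _ = Ψ₀ ^ 2 * r := by ring
    calc _ ≤ ∫ r in (0:ℝ)..1, Ψ₀ ^ 2 * r := integral_mono_on zero_le_one (hXc.intervalIntegrable _ _)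
          ((continuous_const.mul continuous_id).intervalIntegrable _ _) hb
      _ = Ψ₀ ^ 2 / 2 := by rw [intervalIntegral.integral_const_mul, integral_id]; norm_num; ring
  -- Step A2: `∫_1^R ≤ 2 X_F + 2 X_A`
  have hXF := hardy_psiF_le hF ha0 ha2 hR (R := R)
  have hXA := hardy_psiA_le hA lam ha2 hR (a := a) (R := R)
  have hFi : Continuous fun r : ℝ => r * Real.exp (-(2 * ((2 - a) / 8)) * r ^ 2) * (∫ s in (1:ℝ)..r, (Real.sqrt (2 / a) * Real.exp ((2 - a) / 8 * s ^ 2) * Real.sqrt (∫ t in s..R, Real.exp (a / 4 * t ^ 2) * t * F t ^ 2) / max s 1)) ^ 2 :=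
    (hwc _).mul ((continuous_primitive (μ := volume) (fun u v => hFc.intervalIntegrable u v) 1).pow 2)
  have hAi : Continuous fun r : ℝ => r * Real.exp (-(2 * ((2 - a) / 8)) * r ^ 2) * (∫ s in (1:ℝ)..r, (|lam| / 2 * |s| * Real.exp (s ^ 2 / 4) * |A s|)) ^ 2 :=
    (hwc _).mul ((continuous_primitive (μ := volume) (fun u v => hAc.intervalIntegrable u v) 1).pow 2)
  have hA2 : ∫ r in (1:ℝ)..R, r * Real.exp (-(2 * ((2 - a) / 8)) * r ^ 2) * (Real.exp (r ^ 2 / 4) * m r - c) ^ 2 ≤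
      2 * ((4 * ((2 - a) / 8) ^ 2)⁻¹ * ((∫ t in (0:ℝ)..R, Real.exp (a / 4 * t ^ 2) * t * F t ^ 2) / a)) + 2 * ((4 * ((2 - a) / 8) ^ 2)⁻¹ * (lam ^ 2 / 4 * (∫ t in (0:ℝ)..R, Real.exp (a / 4 * t ^ 2) * t * A t ^ 2))) := by
    have hb : ∀ r ∈ Icc (1:ℝ) R, r * Real.exp (-(2 * ((2 - a) / 8)) * r ^ 2) * (Real.exp (r ^ 2 / 4) * m r - c) ^ 2 ≤
        2 * (r * Real.exp (-(2 * ((2 - a) / 8)) * r ^ 2) * (∫ s in (1:ℝ)..r, (Real.sqrt (2 / a) * Real.exp ((2 - a) / 8 * s ^ 2) * Real.sqrt (∫ t in s..R, Real.exp (a / 4 * t ^ 2) * t * F t ^ 2) / max s 1)) ^ 2) +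
          2 * (r * Real.exp (-(2 * ((2 - a) / 8)) * r ^ 2) * (∫ s in (1:ℝ)..r, (|lam| / 2 * |s| * Real.exp (s ^ 2 / 4) * |A s|)) ^ 2) := by
      intro r hr
      have h0 : 0 < r := by linarith [hr.1]
      have hf := hformula r h0
      have hsq := sq_integral_psi_le_far hF hA lam ha0 hflux hr.1 hr.2
      rw [show (Real.exp (r ^ 2 / 4) * m r - c) = ∫ s in (1:ℝ)..r, Real.exp (s ^ 2 / 4) * ((∫ t in (0:ℝ)..s, t * F t) - lam / 2 * s ^ 2 * A s) / s by linarith]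
      have hw0 : 0 ≤ r * Real.exp (-(2 * ((2 - a) / 8)) * r ^ 2) := by positivity
      have hm := mul_le_mul_of_nonneg_left hsq hw0
      linarith only [hm]
    calc _ ≤ ∫ r in (1:ℝ)..R, (2 * (r * Real.exp (-(2 * ((2 - a) / 8)) * r ^ 2) * (∫ s in (1:ℝ)..r, (Real.sqrt (2 / a) * Real.exp ((2 - a) / 8 * s ^ 2) * Real.sqrt (∫ t in s..R, Real.exp (a / 4 * t ^ 2) * t * F t ^ 2) / max s 1)) ^ 2) +
          2 * (r * Real.exp (-(2 * ((2 - a) / 8)) * r ^ 2) * (∫ s in (1:ℝ)..r, (|lam| / 2 * |s| * Real.exp (s ^ 2 / 4) * |A s|)) ^ 2)) :=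
          integral_mono_on hR (hXc.intervalIntegrable _ _) (((hFi.const_mul 2).add (hAi.const_mul 2)).intervalIntegrable _ _) hb
      _ = 2 * (∫ r in (1:ℝ)..R, r * Real.exp (-(2 * ((2 - a) / 8)) * r ^ 2) * (∫ s in (1:ℝ)..r, (Real.sqrt (2 / a) * Real.exp ((2 - a) / 8 * s ^ 2) * Real.sqrt (∫ t in s..R, Real.exp (a / 4 * t ^ 2) * t * F t ^ 2) / max s 1)) ^ 2) +
          2 * ∫ r in (1:ℝ)..R, r * Real.exp (-(2 * ((2 - a) / 8)) * r ^ 2) * (∫ s in (1:ℝ)..r, (|lam| / 2 * |s| * Real.exp (s ^ 2 / 4) * |A s|)) ^ 2 := by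
          rw [intervalIntegral.integral_add ((hFi.intervalIntegrable _ _).const_mul 2)
            ((hAi.intervalIntegrable _ _).const_mul 2), intervalIntegral.integral_const_mul,
            intervalIntegral.integral_const_mul]
      _ ≤ _ := by linarith
  -- Step A: `X ≤ Ψ₀²/2 + 2X_F + 2X_A`
  have hXle : (∫ r in (0:ℝ)..R, r * Real.exp (-(2 * ((2 - a) / 8)) * r ^ 2) * (Real.exp (r ^ 2 / 4) * m r - c) ^ 2) ≤ Ψ₀ ^ 2 / 2 + (2 * ((4 * ((2 - a) / 8) ^ 2)⁻¹ * ((∫ t in (0:ℝ)..R, Real.exp (a / 4 * t ^ 2) * t * F t ^ 2) / a)) +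
      2 * ((4 * ((2 - a) / 8) ^ 2)⁻¹ * (lam ^ 2 / 4 * (∫ t in (0:ℝ)..R, Real.exp (a / 4 * t ^ 2) * t * A t ^ 2)))) := by
    rw [← integral_add_adjacent_intervals (b := 1) (hXc.intervalIntegrable _ _) (hXc.intervalIntegrable _ _)]
    linarith only [hA1, hA2]
  -- Step B: the constant `c`
  have hcsq : c ^ 2 ≤ 25 / (2 * a) * (∫ r in (0:ℝ)..R, r * Real.exp (-(2 * ((2 - a) / 8)) * r ^ 2) * (Real.exp (r ^ 2 / 4) * m r - c) ^ 2) := by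
    -- `c ∫ r e^{-r²/4} = -∫ r e^{-r²/4} Ψ`
    have hpt : ∀ r : ℝ, r * m r = c * (r * Real.exp (-(1 / 4) * r ^ 2)) + r * Real.exp (-(1 / 4) * r ^ 2) * (Real.exp (r ^ 2 / 4) * m r - c) := by
      intro r
      have he : Real.exp (-(1 / 4) * r ^ 2) * Real.exp (r ^ 2 / 4) = 1 := by rw [← Real.exp_add]; ring_nf; simp
      linear_combination (-(r * m r)) * he
    have i1 : IntervalIntegrable (fun r : ℝ => c * (r * Real.exp (-(1 / 4) * r ^ 2))) volume 0 R :=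
      ((hwc _).intervalIntegrable _ _).const_mul c
    have i2 : IntervalIntegrable (fun r : ℝ => r * Real.exp (-(1 / 4) * r ^ 2) * (Real.exp (r ^ 2 / 4) * m r - c)) volume 0 R :=
      ((hwc _).mul hΨc).intervalIntegrable _ _
    have hsplit : c * (∫ r in (0:ℝ)..R, r * Real.exp (-(1 / 4) * r ^ 2)) =
        -∫ r in (0:ℝ)..R, r * Real.exp (-(1 / 4) * r ^ 2) * (Real.exp (r ^ 2 / 4) * m r - c) := by
      have h := hmass
      rw [intervalIntegral.integral_congr (fun r _ => hpt r), intervalIntegral.integral_add i1 i2,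
        intervalIntegral.integral_const_mul] at h
      linarith
    have hI := two_fifths_le_integral_mul_exp_neg hR
    -- Cauchy–Schwarz for the right-hand side
    have hCS : (∫ r in (0:ℝ)..R, |r * Real.exp (-(1 / 4) * r ^ 2) * (Real.exp (r ^ 2 / 4) * m r - c)|) ^ 2 ≤
        (∫ r in (0:ℝ)..R, r * Real.exp (-(2 * ((2 - a) / 8)) * r ^ 2) * (Real.exp (r ^ 2 / 4) * m r - c) ^ 2) * ∫ r in (0:ℝ)..R, r * Real.exp (-(a / 4) * r ^ 2) := by
      have hAm : Continuous fun r : ℝ => |r| * Real.exp (-(2 * ((2 - a) / 8)) * r ^ 2) * (Real.exp (r ^ 2 / 4) * m r - c) ^ 2 :=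
        (continuous_abs.mul (Real.continuous_exp.comp (continuous_const.mul (continuous_pow 2)))).mul (hΨc.pow 2)
      have hBm : Continuous fun r : ℝ => |r| * Real.exp (-(a / 4) * r ^ 2) :=
        continuous_abs.mul (Real.continuous_exp.comp (continuous_const.mul (continuous_pow 2)))
      have h := sq_integral_sqrt_mul_le (μ := volume.restrict (Ioc 0 R))
        (A := fun r => |r| * Real.exp (-(2 * ((2 - a) / 8)) * r ^ 2) * (Real.exp (r ^ 2 / 4) * m r - c) ^ 2) (B := fun r => |r| * Real.exp (-(a / 4) * r ^ 2))
        (fun r => by positivity) (fun r => by positivity) hAm.measurable hBm.measurable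
        (hAm.integrableOn_Icc.mono_set Ioc_subset_Icc_self) (hBm.integrableOn_Icc.mono_set Ioc_subset_Icc_self)
      have hsqrt : ∀ r : ℝ, Real.sqrt (|r| * Real.exp (-(2 * ((2 - a) / 8)) * r ^ 2) * (Real.exp (r ^ 2 / 4) * m r - c) ^ 2 * (|r| * Real.exp (-(a / 4) * r ^ 2))) =
          |r * Real.exp (-(1 / 4) * r ^ 2) * (Real.exp (r ^ 2 / 4) * m r - c)| := by
        intro r
        have he : Real.exp (-(2 * ((2 - a) / 8)) * r ^ 2) * Real.exp (-(a / 4) * r ^ 2) = Real.exp (-(1 / 4) * r ^ 2) ^ 2 := by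
          rw [← Real.exp_add, ← Real.exp_nat_mul]; congr 1; push_cast; ring
        rw [show |r| * Real.exp (-(2 * ((2 - a) / 8)) * r ^ 2) * (Real.exp (r ^ 2 / 4) * m r - c) ^ 2 * (|r| * Real.exp (-(a / 4) * r ^ 2)) =
          (|r| * (Real.exp (r ^ 2 / 4) * m r - c)) ^ 2 * (Real.exp (-(2 * ((2 - a) / 8)) * r ^ 2) * Real.exp (-(a / 4) * r ^ 2)) by ring, he, ← mul_pow,
          Real.sqrt_sq_eq_abs, abs_mul, abs_mul, abs_mul, abs_mul, abs_abs, abs_of_pos (Real.exp_pos _)]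
        ring
      simp_rw [hsqrt] at h
      rw [← integral_of_le hR0, ← integral_of_le hR0, ← integral_of_le hR0] at h
      have e1 : ∫ r in (0:ℝ)..R, |r| * Real.exp (-(2 * ((2 - a) / 8)) * r ^ 2) * (Real.exp (r ^ 2 / 4) * m r - c) ^ 2 = (∫ r in (0:ℝ)..R, r * Real.exp (-(2 * ((2 - a) / 8)) * r ^ 2) * (Real.exp (r ^ 2 / 4) * m r - c) ^ 2) :=
        integral_congr fun r hr => by rw [uIcc_of_le hR0] at hr; rw [abs_of_nonneg hr.1]
      have e2 : ∫ r in (0:ℝ)..R, |r| * Real.exp (-(a / 4) * r ^ 2) = ∫ r in (0:ℝ)..R, r * Real.exp (-(a / 4) * r ^ 2) :=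
        integral_congr fun r hr => by rw [uIcc_of_le hR0] at hr; rw [abs_of_nonneg hr.1]
      rwa [e1, e2] at h
    have hI2 : ∫ r in (0:ℝ)..R, r * Real.exp (-(a / 4) * r ^ 2) ≤ 2 / a := by
      have := integral_id_mul_exp_neg_mul_sq_le (k := a / 4) (by positivity) R
      rw [show -(a / 4) = -(a / 4) by rfl]
      calc _ ≤ 1 / (2 * (a / 4)) := by simpa using this
        _ = 2 / a := by field_simp; norm_num
    have habs : |∫ r in (0:ℝ)..R, r * Real.exp (-(1 / 4) * r ^ 2) * (Real.exp (r ^ 2 / 4) * m r - c)| ≤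
        ∫ r in (0:ℝ)..R, |r * Real.exp (-(1 / 4) * r ^ 2) * (Real.exp (r ^ 2 / 4) * m r - c)| := abs_integral_le_integral_abs hR0
    -- `(2/5 |c|)² ≤ (∫|…|)² ≤ X (2/a)`
    have h1 : (2 / 5 * |c|) ^ 2 ≤ (∫ r in (0:ℝ)..R, r * Real.exp (-(2 * ((2 - a) / 8)) * r ^ 2) * (Real.exp (r ^ 2 / 4) * m r - c) ^ 2) * (2 / a) := by
      have h2 : 2 / 5 * |c| ≤ ∫ r in (0:ℝ)..R, |r * Real.exp (-(1 / 4) * r ^ 2) * (Real.exp (r ^ 2 / 4) * m r - c)| := by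
        calc 2 / 5 * |c| ≤ (∫ r in (0:ℝ)..R, r * Real.exp (-(1 / 4) * r ^ 2)) * |c| :=
              mul_le_mul_of_nonneg_right hI (abs_nonneg _)
          _ = |c * ∫ r in (0:ℝ)..R, r * Real.exp (-(1 / 4) * r ^ 2)| := by
              rw [abs_mul, abs_of_nonneg (show (0:ℝ) ≤ ∫ r in (0:ℝ)..R, r * Real.exp (-(1 / 4) * r ^ 2) by linarith)]
              ring
          _ = |∫ r in (0:ℝ)..R, r * Real.exp (-(1 / 4) * r ^ 2) * (Real.exp (r ^ 2 / 4) * m r - c)| := by rw [hsplit, abs_neg]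
          _ ≤ _ := habs
      calc (2 / 5 * |c|) ^ 2 ≤ (∫ r in (0:ℝ)..R, |r * Real.exp (-(1 / 4) * r ^ 2) * (Real.exp (r ^ 2 / 4) * m r - c)|) ^ 2 :=
            pow_le_pow_left₀ (by positivity) h2 2
        _ ≤ (∫ r in (0:ℝ)..R, r * Real.exp (-(2 * ((2 - a) / 8)) * r ^ 2) * (Real.exp (r ^ 2 / 4) * m r - c) ^ 2) * ∫ r in (0:ℝ)..R, r * Real.exp (-(a / 4) * r ^ 2) := hCS
        _ ≤ (∫ r in (0:ℝ)..R, r * Real.exp (-(2 * ((2 - a) / 8)) * r ^ 2) * (Real.exp (r ^ 2 / 4) * m r - c) ^ 2) * (2 / a) := mul_le_mul_of_nonneg_left hI2 hX0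
    rw [mul_pow, sq_abs] at h1
    calc c ^ 2 = 25 / 4 * ((2 / 5) ^ 2 * c ^ 2) := by ring
      _ ≤ 25 / 4 * ((∫ r in (0:ℝ)..R, r * Real.exp (-(2 * ((2 - a) / 8)) * r ^ 2) * (Real.exp (r ^ 2 / 4) * m r - c) ^ 2) * (2 / a)) := mul_le_mul_of_nonneg_left h1 (by norm_num)
      _ = 25 / (2 * a) * (∫ r in (0:ℝ)..R, r * Real.exp (-(2 * ((2 - a) / 8)) * r ^ 2) * (Real.exp (r ^ 2 / 4) * m r - c) ^ 2) := by ring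
  -- Step C: `N_m ≤ c²/κ + 2X`
  have hC : ∫ r in (0:ℝ)..R, Real.exp (a / 4 * r ^ 2) * r * m r ^ 2 ≤ c ^ 2 * (1 / (2 * ((2 - a) / 8))) + 2 * (∫ r in (0:ℝ)..R, r * Real.exp (-(2 * ((2 - a) / 8)) * r ^ 2) * (Real.exp (r ^ 2 / 4) * m r - c) ^ 2) := by
    have hpt : ∀ r : ℝ, Real.exp (a / 4 * r ^ 2) * r * m r ^ 2 = r * Real.exp (-(2 * ((2 - a) / 8)) * r ^ 2) * (c + (Real.exp (r ^ 2 / 4) * m r - c)) ^ 2 := by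
      intro r
      have he : Real.exp (-(2 * ((2 - a) / 8)) * r ^ 2) * Real.exp (r ^ 2 / 4) ^ 2 = Real.exp (a / 4 * r ^ 2) := by
        rw [← Real.exp_nat_mul, ← Real.exp_add]; congr 1; push_cast; ring
      rw [add_sub_cancel, mul_pow, ← he]; ring
    have hb : ∀ r ∈ Icc (0:ℝ) R, Real.exp (a / 4 * r ^ 2) * r * m r ^ 2 ≤
        c ^ 2 * (2 * (r * Real.exp (-(2 * ((2 - a) / 8)) * r ^ 2))) + 2 * (r * Real.exp (-(2 * ((2 - a) / 8)) * r ^ 2) * (Real.exp (r ^ 2 / 4) * m r - c) ^ 2) := by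
      intro r hr
      rw [hpt r]
      have h0r : 0 ≤ r := hr.1
      have hw0 : 0 ≤ r * Real.exp (-(2 * ((2 - a) / 8)) * r ^ 2) := by positivity
      have h3 : (c + (Real.exp (r ^ 2 / 4) * m r - c)) ^ 2 ≤ 2 * c ^ 2 + 2 * (Real.exp (r ^ 2 / 4) * m r - c) ^ 2 := by
        nlinarith only [sq_nonneg (c - (Real.exp (r ^ 2 / 4) * m r - c))]
      have hm := mul_le_mul_of_nonneg_left h3 hw0
      linarith only [hm]
    have hc1 : Continuous fun r : ℝ => Real.exp (a / 4 * r ^ 2) * r * m r ^ 2 :=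
      ((Real.continuous_exp.comp (continuous_const.mul (continuous_pow 2))).mul continuous_id).mul (hm.pow 2)
    have i1 : IntervalIntegrable (fun r : ℝ => c ^ 2 * (2 * (r * Real.exp (-(2 * ((2 - a) / 8)) * r ^ 2)))) volume 0 R :=
      (((hwc _).intervalIntegrable _ _).const_mul 2).const_mul _
    have i2 : IntervalIntegrable (fun r : ℝ => 2 * (r * Real.exp (-(2 * ((2 - a) / 8)) * r ^ 2) * (Real.exp (r ^ 2 / 4) * m r - c) ^ 2)) volume 0 R :=
      (hXc.intervalIntegrable _ _).const_mul 2
    have hG := integral_id_mul_exp_neg_mul_sq_le hκ R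
    calc _ ≤ ∫ r in (0:ℝ)..R, (c ^ 2 * (2 * (r * Real.exp (-(2 * ((2 - a) / 8)) * r ^ 2))) + 2 * (r * Real.exp (-(2 * ((2 - a) / 8)) * r ^ 2) * (Real.exp (r ^ 2 / 4) * m r - c) ^ 2)) :=
          integral_mono_on hR0 (hc1.intervalIntegrable _ _) (i1.add i2) hb
      _ = c ^ 2 * (2 * ∫ r in (0:ℝ)..R, r * Real.exp (-(2 * ((2 - a) / 8)) * r ^ 2)) + 2 * (∫ r in (0:ℝ)..R, r * Real.exp (-(2 * ((2 - a) / 8)) * r ^ 2) * (Real.exp (r ^ 2 / 4) * m r - c) ^ 2) := by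
          rw [intervalIntegral.integral_add i1 i2, intervalIntegral.integral_const_mul,
            intervalIntegral.integral_const_mul, intervalIntegral.integral_const_mul]
      _ ≤ c ^ 2 * (2 * (1 / (2 * (2 * ((2 - a) / 8))))) + 2 * (∫ r in (0:ℝ)..R, r * Real.exp (-(2 * ((2 - a) / 8)) * r ^ 2) * (Real.exp (r ^ 2 / 4) * m r - c) ^ 2) := by gcongr
      _ = _ := by field_simp
  -- Step D: bookkeeping
  have hk16 : (4 * ((2 - a) / 8) ^ 2)⁻¹ ≤ 16 := by
    rw [inv_le_comm₀ (by positivity) (by norm_num)]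
    nlinarith only [ha1, mul_self_nonneg (1 - a)]
  have hκ4 : 1 / (2 * ((2 - a) / 8)) ≤ 4 := by
    rw [div_le_iff₀ (by positivity)]
    linarith only [ha1]
  exact radial_bookkeeping ha0 ha1 hNF0 hNA0 hX0 hXle hk16 hΨ₀sq hcsq hκ4 (by positivity) hC

end Literature.Analysis.FluidPDE
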